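import Summits.QuantumFields.YangMills.Theorems.BalabanUVNodesN15KingModelSchwingerFunctionsPositivity
import Summits.QuantumFields.YangMills.Theorems.BalabanUVNodesN15KingModelGaussianFieldWick
import Summits.QuantumFields.YangMills.Theorems.BalabanUVNodesN15KingModelReflectionPositivity

/-!
# BalabanUVNodes ∕ N15 — THE KING-MODEL RUNG (PART Ϻ-n): THE INFINITE-VOLUME CONTINUUM BLOCK FIELD AS A MEASURE — `μ_∞ = gaussianFieldOfKernel S₂^{ℝ}` ON `ℝ^{ℤ^{d+1}}`:
# a translation-invariant centred Gaussian probability measure whose `n`-point functions are `Haf(S₂^{ℝ})`, the LIMITS of King's finite-volume `n`-point functions (part Ϸ-d),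
# strictly positive for even `n` (part Ϻ-e), and reflection-positive on linear observables (part Ϸ-k)
# (Track A, DAG node N15 = NE2; FAN-OUT v1.1 §N15 s3 «KING-MODEL RUNG»; uses parts Ϝ-j∕Ϝ-m (`kingS2Inf`, its positive-definiteness), Ͱ-d (Wick for `gaussianFieldOfKernel`), Ϸ-d, Ϸ-k, Ϻ-b∕e;
# count-neutral)

HONEST FRAMING.  Count-neutral (cell `pub-ymgap`, seat `pub-ymgap-dag-n15-e` g35; `--supports stmt-QuantumFields-27366 --as helper` = K3⁸).  King's `A = 0`, `g = 0` model
([King1986] C. King, Commun. Math. Phys. **102** (1986) 649–677).  Theorem 2.1's continuum limit lives on a finite unit torus `Ω`; part Ϸ-d took the subsequent limit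
`|Ω| → ∞` of every `n`-point function of the `K = ∞` block field and found `Haf((S₂^{ℝ}(z_v − z_u))_{u,v})`.  THIS FILE realises that limit as a MEASURE: the kernel
`K(z,w) = S₂^{ℝ}(w − z)` on `ℤ^{d+1}` is positive semidefinite (part Ϝ-m's `kingS2Inf_posSemidef`, symmetric by evenness), so the tree's Kolmogorov construction
`gaussianFieldOfKernel` (`Literature…CurvatureGaussianField`) yields a centred Gaussian PROBABILITY MEASURE `μ_∞` on `ℝ^{ℤ^{d+1}}` (product σ-algebra) with covariance `S₂^{ℝ}`;
by part Ͱ-d's Wick theorem its `n`-point functions ARE `Haf(S₂^{ℝ})`, hence ★★★ EQUAL TO THE THERMODYNAMIC LIMITS of King's finite-volume `n`-point functions (the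
infinite-volume continuum block field EXISTS as a measure and the finite-volume laws converge to it in the sense of all moments); `μ_∞` is TRANSLATION INVARIANT
(uniqueness of the Gaussian field of a kernel, Kallenberg 13.1, + `K(z+v,w+v) = K(z,w)`); every EVEN moment is STRICTLY positive (part Ϻ-b∕e) and odd ones vanish; and
the covariance reflection positivity of part Ϸ-k becomes `∫ (θF)·F dμ_∞ ≥ 0` for LINEAR observables `F = Σc_iφ(z_i)` supported in a half-space (the polynomial ∕ exponential
algebra — reflection positivity of the LAW — is not typed here).  NOT Bałaban's objects; NOT a node discharge; nothing continuum-Yang–Mills ∕ `ℝ⁴` ∕ OS reconstruction ∕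
Clay — a FREE lattice-indexed Gaussian field.  0 `sorry`; standard axioms; TWO definitions (`kingKernel`, `kingFieldInf`).

WHAT THIS FILE PROVES (kernel).  §1 `kingKernel` (+ `_apply`, `_symm`, `_add`), `sum_sum_dite_eq`, ★★ **`isPosSemidefKernel_kingKernel`**.  §2 `kingFieldInf`, ★ `isProbabilityMeasure_kingFieldInf`,
`integral_eval_kingFieldInf` (centred), ★ `integral_eval_mul_eval_kingFieldInf` (`= S₂^{ℝ}(w−z)`), ★★★ **`integral_prod_eval_kingFieldInf_eq_hafnian`**, `…_eq_zero_of_odd`, ★★ `integral_prod_eval_kingFieldInf_pos`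
(even), ★★★ **`tendsto_nPoint_volume_kingFieldInf`** (THE THERMODYNAMIC LIMIT AS A MEASURE).  §3 `measurable_shift`, ★★★ **`kingFieldInf_map_shift`** (translation invariance of the law).
§4 `integrable_eval_mul_eval_kingFieldInf`, ★★ **`kingFieldInf_rp_linear`** (reflection positivity on linear observables).

HONEST SCOPE.  King's free model, `m² > 0`, every `d`; convergence «in the sense of moments» (all `n`-point functions), no weak-convergence statement typed; RP only for linear
observables.  N15 untouched; counts unmoved.  Locators (use): [King1986] Thm 2.1 (2.22)–(2.23) p.654, (4.5) p.670, Thm 3.3 (3.6) p.655; [Kallenberg2002] Lemma 13.1.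
-/

noncomputable section

open scoped BigOperators Topology
open Filter MeasureTheory ProbabilityTheory Finset

namespace Summit.QuantumFields.YangMills.BalabanUVNodes.N15KingModelRung.InfiniteVolume

open Literature.MathematicalPhysics.QuantumFieldTheory (IsPosSemidefKernel covGram covGram_apply gaussianFieldOfKernel isProbabilityMeasure_gaussianFieldOfKernel
  isGaussianProcess_eval_gaussianFieldOfKernel integral_eval_gaussianFieldOfKernel covariance_eval_gaussianFieldOfKernel eq_gaussianFieldOfKernel_of_isGaussianProcess)
open Literature.MathematicalPhysics.QuantumFieldTheory.Balaban1983to89.B5Prop11Plancherel (Tor)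
open Literature.Combinatorics.Enumerative (hafnian)
open Literature.Combinatorics.Enumerative.HafnianGeneratingFunction (subMat)
open Summit.QuantumFields.YangMills.BalabanUVNodes.N15KingModelRung.FreeField
open Summit.QuantumFields.YangMills.BalabanUVNodes.N15KingModelRung.OptimalDecay
open Summit.QuantumFields.YangMills.BalabanUVNodes.N15KingModelRung.ProperTime

variable {d : ℕ}

/-! ## §1 The infinite-volume kernel `K(z,w) = S₂^{ℝ}(w − z)` is positive semidefinite -/

/-- The infinite-volume covariance kernel of King's continuum block field: `K(z,w) = S₂^{ℝ}(w − z)`, `z, w ∈ ℤ^{d+1}`. [cite: King1986, Thm 2.1 (2.22) p.654, (4.5) p.670] -/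
def kingKernel (m2 : ℝ) (z w : Fin (d + 1) → ℤ) : ℝ := kingS2Inf m2 (w - z)

/-- `K(z,w) = S₂^{ℝ}(w − z)`. [folklore] -/
theorem kingKernel_apply (m2 : ℝ) (z w : Fin (d + 1) → ℤ) : kingKernel m2 z w = kingS2Inf m2 (w - z) := rfl

/-- `K` is symmetric (`S₂^{ℝ}` is even). [cite: King1986, Thm 2.1 (2.22) p.654] -/
theorem kingKernel_symm (m2 : ℝ) (z w : Fin (d + 1) → ℤ) : kingKernel m2 z w = kingKernel m2 w z := by
  unfold kingKernel
  rw [← kingS2Inf_neg m2 (w - z), neg_sub]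

/-- `K` is translation invariant: `K(z+v, w+v) = K(z,w)`. [folklore] -/
theorem kingKernel_add (m2 : ℝ) (z w v : Fin (d + 1) → ℤ) : kingKernel m2 (z + v) (w + v) = kingKernel m2 z w := by
  unfold kingKernel
  rw [add_sub_add_right_eq_sub]

/-- A double sum over `I` of terms guarded by membership is the double sum over the subtype `↥I`. [folklore] -/
theorem sum_sum_dite_eq {α : Type*} [DecidableEq α] (I : Finset α) (x : I → ℝ) (F : α → α → ℝ) :
    ∑ z ∈ I, ∑ z' ∈ I, (if hz : z ∈ I then x ⟨z, hz⟩ else 0) * F z z' * (if hz' : z' ∈ I then x ⟨z', hz'⟩ else 0)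
      = ∑ s : I, ∑ t : I, x s * F s t * x t := by
  rw [← Finset.sum_coe_sort I]
  refine Finset.sum_congr rfl fun s _ => ?_
  rw [← Finset.sum_coe_sort I]
  refine Finset.sum_congr rfl fun t _ => ?_
  rw [dif_pos s.2, dif_pos t.2]

/-- ★★ **`K(z,w) = S₂^{ℝ}(w−z)` IS A POSITIVE-SEMIDEFINITE KERNEL ON `ℤ^{d+1}`** (part Ϝ-m's positive-definiteness of `S₂^{ℝ}` + evenness). [cite: King1986, Thm 2.1 (2.22) p.654] -/
theorem isPosSemidefKernel_kingKernel {m2 : ℝ} (hm : 0 < m2) : IsPosSemidefKernel (kingKernel (d := d) m2) := by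
  intro I
  refine Matrix.PosSemidef.of_dotProduct_mulVec_nonneg ?_ fun x => ?_
  · ext s t
    simp only [Matrix.conjTranspose_apply, covGram_apply, star_trivial]
    exact kingKernel_symm m2 _ _
  · have h := kingS2Inf_posSemidef hm I (fun z => if hz : z ∈ I then x ⟨z, hz⟩ else 0)
    rw [sum_sum_dite_eq I x (fun z z' => kingS2Inf m2 (z' - z))] at h
    have e : star x ⬝ᵥ (covGram (kingKernel m2) I).mulVec x = ∑ s : I, ∑ t : I, x s * kingS2Inf m2 ((t : Fin (d + 1) → ℤ) - (s : Fin (d + 1) → ℤ)) * x t := by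
      simp only [star_trivial, dotProduct, Matrix.mulVec, covGram_apply, kingKernel, Finset.mul_sum]
      refine Finset.sum_congr rfl fun s _ => Finset.sum_congr rfl fun t _ => ?_
      ring
    rw [e]
    exact h

/-! ## §2 The infinite-volume continuum block field `μ_∞` -/

/-- **KING's INFINITE-VOLUME CONTINUUM BLOCK FIELD**: the centred Gaussian probability measure on `ℝ^{ℤ^{d+1}}` (product σ-algebra) with covariance `S₂^{ℝ}(w − z)` — the Kolmogorov
extension of the consistent family of finite-dimensional Gaussian laws (the tree's `gaussianFieldOfKernel`). [cite: King1986, Thm 2.1 (2.22) p.654, (4.5) p.670; Kallenberg2002, Lemma 13.1] -/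
def kingFieldInf (m2 : ℝ) : Measure ((Fin (d + 1) → ℤ) → ℝ) := gaussianFieldOfKernel (kingKernel m2)

/-- ★ `μ_∞` is a probability measure. [folklore] -/
theorem isProbabilityMeasure_kingFieldInf {m2 : ℝ} (hm : 0 < m2) : IsProbabilityMeasure (kingFieldInf (d := d) m2) :=
  isProbabilityMeasure_gaussianFieldOfKernel (isPosSemidefKernel_kingKernel hm)

/-- `μ_∞` is centred: `∫φ(z)dμ_∞ = 0`. [folklore] -/
theorem integral_eval_kingFieldInf {m2 : ℝ} (hm : 0 < m2) (z : Fin (d + 1) → ℤ) : ∫ ω, ω z ∂kingFieldInf m2 = 0 :=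
  integral_eval_gaussianFieldOfKernel (isPosSemidefKernel_kingKernel hm) z

/-- ★ **The two-point function of `μ_∞` is `S₂^{ℝ}`**: `∫φ(z)φ(w)dμ_∞ = S₂^{ℝ}(w − z)`. [cite: King1986, Thm 2.1 (2.22) p.654] -/
theorem integral_eval_mul_eval_kingFieldInf {m2 : ℝ} (hm : 0 < m2) (z w : Fin (d + 1) → ℤ) :
    ∫ ω, ω z * ω w ∂kingFieldInf m2 = kingS2Inf m2 (w - z) :=
  integral_eval_mul_eval_gaussianFieldOfKernel (isPosSemidefKernel_kingKernel hm) z w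

/-- ★★★ **ALL `n`-POINT FUNCTIONS OF `μ_∞` ARE HAFNIANS OF `S₂^{ℝ}`**: for sites `z : W → ℤ^{d+1}` and finite `S`,
`∫∏_{i∈S}φ(z_i)dμ_∞ = Haf((S₂^{ℝ}(z_v − z_u))_{u,v∈S})` (part Ͱ-d's Wick theorem for `gaussianFieldOfKernel`). [cite: King1986, Thm 2.1 (2.22)–(2.23) p.654] -/
theorem integral_prod_eval_kingFieldInf_eq_hafnian {m2 : ℝ} (hm : 0 < m2) {W : Type*} [DecidableEq W] [LinearOrder W] (z : W → Fin (d + 1) → ℤ) (S : Finset W) :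
    ∫ ω, (∏ i ∈ S, ω (z i)) ∂kingFieldInf m2 = hafnian (subMat (Matrix.of fun u v : W => kingS2Inf m2 (z v - z u)) S) :=
  integral_prod_eval_gaussianFieldOfKernel_eq_hafnian (isPosSemidefKernel_kingKernel hm) z S

/-- Odd `n`-point functions of `μ_∞` vanish. [folklore] -/
theorem integral_prod_eval_kingFieldInf_eq_zero_of_odd {m2 : ℝ} (hm : 0 < m2) {W : Type*} [DecidableEq W] [LinearOrder W] (z : W → Fin (d + 1) → ℤ) {S : Finset W}
    (hS : Odd S.card) : ∫ ω, (∏ i ∈ S, ω (z i)) ∂kingFieldInf m2 = 0 := by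
  rw [integral_prod_eval_kingFieldInf_eq_hafnian hm z S]
  exact hafnian_kingS2Inf_eq_zero_of_odd m2 z hS

/-- ★★ Every EVEN `n`-point function of `μ_∞` is STRICTLY POSITIVE (part Ϻ-e). [cite: King1986, Thm 2.1 (2.22) p.654] -/
theorem integral_prod_eval_kingFieldInf_pos {m2 : ℝ} (hm : 0 < m2) {W : Type*} [DecidableEq W] [LinearOrder W] (z : W → Fin (d + 1) → ℤ) {S : Finset W}
    (hS : Even S.card) : 0 < ∫ ω, (∏ i ∈ S, ω (z i)) ∂kingFieldInf m2 := by
  rw [integral_prod_eval_kingFieldInf_eq_hafnian hm z S]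
  exact hafnian_kingS2Inf_pos hm z hS

/-- ★★★ **THE THERMODYNAMIC LIMIT AS A MEASURE**: for every finite family of lattice sites `z : W → ℤ^{d+1}`, every finite `S`, and ANY sequence of unit tori `Ω_k` with all periods
`→ ∞`, King's finite-volume `K = ∞` block-field `n`-point functions converge to the `n`-point functions of `μ_∞`:
`∫∏_{i∈S}φ(z_i mod Ω_k)ρ_{P_∞,Ω_k}(φ)dφ → ∫∏_{i∈S}φ(z_i)dμ_∞` — the infinite-volume continuum block field EXISTS as the probability measure `μ_∞` and the finite-volume laws
converge to it in the sense of all moments. [cite: King1986, Thm 2.1 (2.22)–(2.23) p.654, (4.5) p.670] -/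
theorem tendsto_nPoint_volume_kingFieldInf {m2 : ℝ} (hm : 0 < m2) (Mseq : ℕ → Fin (d + 1) → ℕ) (hpos : ∀ k ν, 0 < Mseq k ν)
    (hlim : ∀ ν, Tendsto (fun k => (Mseq k ν : ℝ)) atTop atTop) {W : Type*} [DecidableEq W] [LinearOrder W] (z : W → Fin (d + 1) → ℤ) (S : Finset W) :
    Tendsto (fun k => haveI : ∀ ν, NeZero (Mseq k ν) := fun ν => ⟨(hpos k ν).ne'⟩
      ∫ φ : Tor (Mseq k) → ℝ, (∏ i ∈ S, φ (fun ν => ((z i ν : ℤ) : ZMod (Mseq k ν)))) * gaussDensity (fineBlockPrecLim (Mseq k) m2) φ) atTop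
      (𝓝 (∫ ω, (∏ i ∈ S, ω (z i)) ∂kingFieldInf m2)) := by
  rw [integral_prod_eval_kingFieldInf_eq_hafnian hm z S]
  exact tendsto_integral_prod_eval_fineBlockLawLim_volume hm Mseq hpos hlim z S

/-! ## §3 Translation invariance of `μ_∞` -/

/-- The shift `(T_vφ)(z) = φ(z + v)` is measurable on the product space. [folklore] -/
theorem measurable_shift (v : Fin (d + 1) → ℤ) : Measurable fun (ω : (Fin (d + 1) → ℤ) → ℝ) (z : Fin (d + 1) → ℤ) => ω (z + v) :=
  measurable_pi_lambda _ fun z => measurable_pi_apply (z + v)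

/-- ★★★ **`μ_∞` IS TRANSLATION INVARIANT**: the push-forward of `μ_∞` under `φ ↦ φ(· + v)` is `μ_∞`, for every `v ∈ ℤ^{d+1}` (the shifted coordinate process is a centred Gaussian
process with the same covariance `S₂^{ℝ}(w − z)`; uniqueness, Kallenberg 13.1). [cite: King1986, Thm 2.1 (2.22) p.654; Kallenberg2002, Lemma 13.1] -/
theorem kingFieldInf_map_shift {m2 : ℝ} (hm : 0 < m2) (v : Fin (d + 1) → ℤ) :
    (kingFieldInf m2).map (fun (ω : (Fin (d + 1) → ℤ) → ℝ) (z : Fin (d + 1) → ℤ) => ω (z + v)) = kingFieldInf m2 := by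
  have hK := isPosSemidefKernel_kingKernel (d := d) hm
  haveI := isProbabilityMeasure_kingFieldInf (d := d) hm
  set T : ((Fin (d + 1) → ℤ) → ℝ) → ((Fin (d + 1) → ℤ) → ℝ) := fun ω z => ω (z + v) with hT
  have hTm : Measurable T := measurable_shift v
  haveI : IsProbabilityMeasure ((kingFieldInf m2).map T) := Measure.isProbabilityMeasure_map hTm.aemeasurable
  unfold kingFieldInf at *
  refine eq_gaussianFieldOfKernel_of_isGaussianProcess hK ?_ (fun s => ?_) (fun s t => ?_)
  · -- the coordinate process under the push-forward is the shifted process, Gaussian by `comp_right`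
    have hX := (isGaussianProcess_eval_gaussianFieldOfKernel hK).comp_right (fun s : Fin (d + 1) → ℤ => s + v)
    refine ⟨fun I => ⟨?_⟩⟩
    have hg : Measurable (fun ω : (Fin (d + 1) → ℤ) → ℝ => I.restrict fun x => ω x) := Finset.measurable_restrict I
    rw [Measure.map_map hg hTm]
    have hfun : ((fun ω : (Fin (d + 1) → ℤ) → ℝ => I.restrict fun x => ω x) ∘ T) = fun ω => I.restrict fun s => ((fun (s : Fin (d + 1) → ℤ) (ω : (Fin (d + 1) → ℤ) → ℝ) => ω s) ∘ fun s => s + v) s ω := by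
      funext ω; rfl
    rw [hfun]
    exact (hX.hasGaussianLaw I).isGaussian_map
  · rw [integral_map hTm.aemeasurable (measurable_pi_apply s).aestronglyMeasurable]
    exact integral_eval_gaussianFieldOfKernel hK (s + v)
  · rw [covariance_map (measurable_pi_apply s).aestronglyMeasurable (measurable_pi_apply t).aestronglyMeasurable hTm.aemeasurable]
    have h := covariance_eval_gaussianFieldOfKernel hK (s + v) (t + v)
    rw [kingKernel_add] at h
    exact h

/-! ## §4 Reflection positivity on linear observables -/

/-- Products of two coordinates are `μ_∞`-integrable (Gaussian marginals have all moments). [folklore] -/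
theorem integrable_eval_mul_eval_kingFieldInf {m2 : ℝ} (hm : 0 < m2) (z w : Fin (d + 1) → ℤ) :
    Integrable (fun ω : (Fin (d + 1) → ℤ) → ℝ => ω z * ω w) (kingFieldInf m2) := by
  have hG := isGaussianProcess_eval_gaussianFieldOfKernel (isPosSemidefKernel_kingKernel (d := d) hm)
  exact ((hG.hasGaussianLaw_eval z).memLp_two).integrable_mul ((hG.hasGaussianLaw_eval w).memLp_two)

/-- ★★ **REFLECTION POSITIVITY OF `μ_∞` ON LINEAR OBSERVABLES**: for the block reflection `θ_ν z = (z_⊥, −z_ν − 1)`, sites `z_i` in the half-lattice `(z_i)_ν ≥ 0` and real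
coefficients, `0 ≤ ∫ (Σ_i c_iφ(θ_ν z_i))·(Σ_j c_jφ(z_j)) dμ_∞` (part Ϸ-k's covariance reflection positivity read under the measure).
[cite: King1986, Thm 2.1 (2.22) p.654, Thm 3.3 (3.6) p.655] -/
theorem kingFieldInf_rp_linear {m2 : ℝ} (hm : 0 < m2) (ν : Fin (d + 1)) {ι : Type*} (s : Finset ι) (c : ι → ℝ) (z : ι → Fin (d + 1) → ℤ)
    (hz : ∀ i ∈ s, 0 ≤ z i ν) :
    0 ≤ ∫ ω, (∑ i ∈ s, c i * ω (Function.update (z i) ν (-(z i ν) - 1))) * (∑ j ∈ s, c j * ω (z j)) ∂kingFieldInf m2 := by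
  have hint : ∀ i j, Integrable (fun ω : (Fin (d + 1) → ℤ) → ℝ => c i * c j * (ω (Function.update (z i) ν (-(z i ν) - 1)) * ω (z j))) (kingFieldInf m2) :=
    fun i j => (integrable_eval_mul_eval_kingFieldInf hm _ _).const_mul _
  have hexp : (fun ω : (Fin (d + 1) → ℤ) → ℝ => (∑ i ∈ s, c i * ω (Function.update (z i) ν (-(z i ν) - 1))) * (∑ j ∈ s, c j * ω (z j)))
      = fun ω => ∑ i ∈ s, ∑ j ∈ s, c i * c j * (ω (Function.update (z i) ν (-(z i ν) - 1)) * ω (z j)) := by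
    funext ω
    rw [Finset.sum_mul_sum]
    refine Finset.sum_congr rfl fun i _ => Finset.sum_congr rfl fun j _ => ?_
    ring
  rw [hexp, integral_finsetSum _ fun i _ => integrable_finsetSum _ fun j _ => hint i j]
  simp_rw [integral_finsetSum _ fun j _ => hint _ j, integral_const_mul, integral_eval_mul_eval_kingFieldInf hm]
  have hsym : ∀ i j, kingS2Inf m2 (z j - Function.update (z i) ν (-(z i ν) - 1)) = kingS2Inf m2 (Function.update (z i) ν (-(z i ν) - 1) - z j) := by
    intro i j
    rw [← kingS2Inf_neg m2, neg_sub]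
  simp_rw [hsym]
  exact kingS2Inf_reflection_positive hm ν s c z hz

end Summit.QuantumFields.YangMills.BalabanUVNodes.N15KingModelRung.InfiniteVolume
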